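import Summits.Ventures.CertifiedManyBodySolver.Downfold.S2Seam
import Literature.MathematicalPhysics.QuantumLattice.HubbardTTPrimeParticleHoleImageWords
import HarnessLib

/-!
# The PARTICLE–HOLE IMAGE seam for typed one-band boxes: an S2 word stated on the IMAGE cell
# `(U/t, −tp/t, 2 − n)` of a box (the hole-side column a `t–t'` solver certifies) becomes a word ON the box,
# with the exact shift `U·(n − 1)` — entry points for the ELECTRON-DOPED boxes of record (NCCO #20, SLCO #37, …)

Venture CertifiedManyBodySolver, cell `pub/hubbard-downfold` (stage S1 ↔ S2 seam), seat hubbard-downfold-mod-1; namespace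
`Summit.Ventures.CertifiedManyBodySolver.Downfold`. The electron-doped validation materials (Nd₂₋ₓCeₓCuO₄ #20/M55/M56,
Sr₁₋ₓLaₓCuO₂ #37) are routed with `n > 1` and `tp/t < 0`; hubbard-fast's atlas and every certificate live at `n ≤ 1`, so their
box files print «coverage = 𝒟 via the PH image only» and hubbard-box-p2/p3 state their words on the IMAGE cell
`[U_lo, U_hi] × [−tp_hi, −tp_lo] × [2 − n_hi, 2 − n_lo]` (`Certificates/HubbardSquare_sandwich_electronDoped.lean`,
`Literature/…/HubbardTTPrimeParticleHoleImageWords.lean` = the device: `e(t, t', U, n) = e(t, −t', U, 2 − n) + U(n − 1)` for `U ≥ 0`,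
`0 < n < 2`, [LiebWuPhysicaA2003 §1 eq. (3)]). This file is the seam's side of it, generic in the box:

* `phLo / phHi eU eS eN` — the image cell's corners from the box's `U/t`, `tp/t`, `n` entries; `phCoords p = (p U/t, −p tp/t, 2 − p n)`;
  `phCoords_mem_Icc` — every member's image point lies in `Set.Icc (phLo …) (phHi …)`.
* `holdsOn_of_phImage_windowFun` — the GENERAL entry point: any pointwise enclosure `F θ ≤ e₀(1, θ 1, θ 0, θ 2) ≤ C θ` on the image cell
  (constant, affine, multilinear …) gives `F(phCoords p) + U(n − 1) ≤ e₀(1, tp/t, U/t, n) ≤ C(phCoords p) + U(n − 1)` on the box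
  (`eU.lo ≥ 0`, `0 < eN.lo`, `eN.hi < 2`).
* `holdsOn_of_phImage_window` — constant window `[lo, hi]` on the image ⇒ `[lo + U(n−1), hi + U(n−1)]` on the box (exact, pointwise);
* `holdsOn_of_phImage_window_const` — the same as ONE constant pair when the box is electron-doped (`eN.lo ≥ 1`):
  `[lo + U_lo(n_lo − 1), hi + U_hi(n_hi − 1)]` (the pair pays the spread of `U(n − 1)` over the box; the `_window` form is exact).

HONEST FRAMING: pure transport lemmas (no number about any material); energy words only; the identity is the bipartite particle–hole
map of the `t–t'` Hubbard model at `U ≥ 0` — it says nothing about order, pairing, `T_c` or a phase word, and nothing about the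
`t''` object (whose sign does NOT flip under the map: `t''` bonds are same-sublattice like `t'` — an object-M image seam would send
`(t', t'') ↦ (−t', −t'')`; not in this file). Everything is PROVED; the two `def`s are corner vectors; no `sorry`.
-/

noncomputable section

namespace Summit.Ventures.CertifiedManyBodySolver.Downfold

open NonemptyInterval Literature.MathematicalPhysics.QuantumLattice
  Literature.MathematicalPhysics.QuantumLattice.ThermodynamicLimit

/-- Lower corner of the PARTICLE–HOLE IMAGE of the delivered S2 box: `(U_lo, −tp_hi, 2 − n_hi)`. [cite: LiebWuPhysicaA2003, §1 eq. (3)] -/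
def phLo (eU eS eN : Entry) : Fin 3 → ℝ :=
  ![((eU.encl.fst : ℚ) : ℝ), -((eS.encl.snd : ℚ) : ℝ), 2 - ((eN.encl.snd : ℚ) : ℝ)]

/-- Upper corner of the PARTICLE–HOLE IMAGE of the delivered S2 box: `(U_hi, −tp_lo, 2 − n_lo)`. [cite: LiebWuPhysicaA2003, §1 eq. (3)] -/
def phHi (eU eS eN : Entry) : Fin 3 → ℝ :=
  ![((eU.encl.snd : ℚ) : ℝ), -((eS.encl.fst : ℚ) : ℝ), 2 - ((eN.encl.fst : ℚ) : ℝ)]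

/-- The image point of a parameter vector in S2's order: `(U/t, −tp/t, 2 − n)`. [cite: LiebWuPhysicaA2003, §1 eq. (3)] -/
def phCoords (p : OneBandCoord → ℝ) : Fin 3 → ℝ := ![p .UOverT, -p .tpOverT, 2 - p .filling]

/-- The three image coordinates by name. [folklore] -/
theorem phCoords_apply (p : OneBandCoord → ℝ) :
    phCoords p 0 = p .UOverT ∧ phCoords p 1 = -p .tpOverT ∧ phCoords p 2 = 2 - p .filling := by
  simp [phCoords]

/-- **Every member's image point lies in the image cell.** [folklore] -/
theorem phCoords_mem_Icc {B : OneBandBox} {eU eS eN : Entry} (hU : B .UOverT = some eU)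
    (hS : B .tpOverT = some eS) (hN : B .filling = some eN) {p : OneBandCoord → ℝ} (hp : B.Mem p) :
    phCoords p ∈ Set.Icc (phLo eU eS eN) (phHi eU eS eN) := by
  have hm := s2Coords_mem_Icc hU hS hN hp
  rw [Set.mem_Icc, Pi.le_def, Pi.le_def] at hm
  have hUlo : ((eU.encl.fst : ℚ) : ℝ) ≤ p .UOverT := by simpa [s2Lo, s2Coords] using hm.1 0
  have hUhi : p .UOverT ≤ ((eU.encl.snd : ℚ) : ℝ) := by simpa [s2Hi, s2Coords] using hm.2 0
  have hSlo : ((eS.encl.fst : ℚ) : ℝ) ≤ p .tpOverT := by simpa [s2Lo, s2Coords] using hm.1 1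
  have hShi : p .tpOverT ≤ ((eS.encl.snd : ℚ) : ℝ) := by simpa [s2Hi, s2Coords] using hm.2 1
  have hNlo : ((eN.encl.fst : ℚ) : ℝ) ≤ p .filling := by simpa [s2Lo, s2Coords] using hm.1 2
  have hNhi : p .filling ≤ ((eN.encl.snd : ℚ) : ℝ) := by simpa [s2Hi, s2Coords] using hm.2 2
  rw [Set.mem_Icc, Pi.le_def, Pi.le_def]
  refine ⟨fun i => ?_, fun i => ?_⟩ <;> fin_cases i <;> simp [phLo, phHi, phCoords] <;> linarith

/-- **GENERAL PH-IMAGE ENTRY POINT.** Let `B` carry entries `eU, eS, eN` (`eU.lo ≥ 0`, `0 < eN.lo`, `eN.hi < 2`) and let S2 state ANY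
pointwise enclosure `F θ ≤ e₀(1, θ 1, θ 0, θ 2) ≤ C θ` on the image cell `Set.Icc (phLo eU eS eN) (phHi eU eS eN)`. Then at every member,
`F(phCoords p) + U(n − 1) ≤ e₀(1, tp/t, U/t, n) ≤ C(phCoords p) + U(n − 1)`. [cite: LiebWuPhysicaA2003, §1 eq. (3)] -/
theorem holdsOn_of_phImage_windowFun {B : OneBandBox} {eU eS eN : Entry} (hU : B .UOverT = some eU)
    (hS : B .tpOverT = some eS) (hN : B .filling = some eN) (hU0 : 0 ≤ eU.encl.fst) (hN0 : 0 < eN.encl.fst)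
    (hN2 : eN.encl.snd < 2) {F C : (Fin 3 → ℝ) → ℝ}
    (hW : ∀ θ ∈ Set.Icc (phLo eU eS eN) (phHi eU eS eN),
      F θ ≤ energyDensityTT' 1 (θ 1) (θ 0) (θ 2) ∧ energyDensityTT' 1 (θ 1) (θ 0) (θ 2) ≤ C θ) :
    HoldsOn (fun p : OneBandCoord → ℝ =>
      F (phCoords p) + p .UOverT * (p .filling - 1) ≤ energyDensityTT' 1 (p .tpOverT) (p .UOverT) (p .filling) ∧
        energyDensityTT' 1 (p .tpOverT) (p .UOverT) (p .filling) ≤ C (phCoords p) + p .UOverT * (p .filling - 1)) B := by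
  intro p hp
  have hm := s2Coords_mem_Icc hU hS hN hp
  rw [Set.mem_Icc, Pi.le_def, Pi.le_def] at hm
  have hUlo : ((eU.encl.fst : ℚ) : ℝ) ≤ p .UOverT := by simpa [s2Lo, s2Coords] using hm.1 0
  have hNlo : ((eN.encl.fst : ℚ) : ℝ) ≤ p .filling := by simpa [s2Lo, s2Coords] using hm.1 2
  have hNhi : p .filling ≤ ((eN.encl.snd : ℚ) : ℝ) := by simpa [s2Hi, s2Coords] using hm.2 2
  have hU' : 0 ≤ p .UOverT := le_trans (by exact_mod_cast hU0) hUlo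
  have hn0 : 0 < p .filling := lt_of_lt_of_le (by exact_mod_cast hN0) hNlo
  have hn2 : p .filling < 2 := lt_of_le_of_lt hNhi (by exact_mod_cast hN2)
  have hw := hW _ (phCoords_mem_Icc hU hS hN hp)
  simp only [phCoords, Matrix.cons_val_zero, Matrix.cons_val_one, Matrix.head_cons, Matrix.cons_val_two,
    Matrix.tail_cons] at hw
  have hid := energyDensityTT'_particleHole 1 (p .tpOverT) hU' hn0 hn2
  refine ⟨?_, ?_⟩
  · simp only [phCoords]; linarith [hw.1]
  · simp only [phCoords]; linarith [hw.2]

/-- **PH-IMAGE ENTRY POINT, constant window, exact shift.** An S2 window `lo ≤ e₀ ≤ hi` on the image cell gives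
`lo + U(n − 1) ≤ e₀(1, tp/t, U/t, n) ≤ hi + U(n − 1)` at every member. [cite: LiebWuPhysicaA2003, §1 eq. (3)] -/
theorem holdsOn_of_phImage_window {B : OneBandBox} {eU eS eN : Entry} (hU : B .UOverT = some eU)
    (hS : B .tpOverT = some eS) (hN : B .filling = some eN) (hU0 : 0 ≤ eU.encl.fst) (hN0 : 0 < eN.encl.fst)
    (hN2 : eN.encl.snd < 2) {lo hi : ℝ}
    (hW : ∀ θ ∈ Set.Icc (phLo eU eS eN) (phHi eU eS eN),
      lo ≤ energyDensityTT' 1 (θ 1) (θ 0) (θ 2) ∧ energyDensityTT' 1 (θ 1) (θ 0) (θ 2) ≤ hi) :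
    HoldsOn (fun p : OneBandCoord → ℝ =>
      lo + p .UOverT * (p .filling - 1) ≤ energyDensityTT' 1 (p .tpOverT) (p .UOverT) (p .filling) ∧
        energyDensityTT' 1 (p .tpOverT) (p .UOverT) (p .filling) ≤ hi + p .UOverT * (p .filling - 1)) B :=
  holdsOn_of_phImage_windowFun hU hS hN hU0 hN0 hN2 (F := fun _ => lo) (C := fun _ => hi) hW

/-- **PH-IMAGE ENTRY POINT, ONE constant pair on an ELECTRON-DOPED box** (`eN.lo ≥ 1`): an S2 window `[lo, hi]` on the image cell gives
`lo + U_lo(n_lo − 1) ≤ e₀(1, tp/t, U/t, n) ≤ hi + U_hi(n_hi − 1)` at every member (`0 ≤ U(n − 1)` is monotone in both factors there; the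
pair pays its spread over the box — use `holdsOn_of_phImage_window` for the exact form). [cite: LiebWuPhysicaA2003, §1 eq. (3)] -/
theorem holdsOn_of_phImage_window_const {B : OneBandBox} {eU eS eN : Entry} (hU : B .UOverT = some eU)
    (hS : B .tpOverT = some eS) (hN : B .filling = some eN) (hU0 : 0 ≤ eU.encl.fst) (hN1 : 1 ≤ eN.encl.fst)
    (hN2 : eN.encl.snd < 2) {lo hi : ℝ}
    (hW : ∀ θ ∈ Set.Icc (phLo eU eS eN) (phHi eU eS eN),
      lo ≤ energyDensityTT' 1 (θ 1) (θ 0) (θ 2) ∧ energyDensityTT' 1 (θ 1) (θ 0) (θ 2) ≤ hi) :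
    HoldsOn (fun p : OneBandCoord → ℝ =>
      lo + ((eU.encl.fst : ℚ) : ℝ) * (((eN.encl.fst : ℚ) : ℝ) - 1) ≤
          energyDensityTT' 1 (p .tpOverT) (p .UOverT) (p .filling) ∧
        energyDensityTT' 1 (p .tpOverT) (p .UOverT) (p .filling) ≤
          hi + ((eU.encl.snd : ℚ) : ℝ) * (((eN.encl.snd : ℚ) : ℝ) - 1)) B := by
  intro p hp
  have hw := holdsOn_of_phImage_window hU hS hN hU0 (lt_of_lt_of_le zero_lt_one hN1) hN2 hW p hp
  have hm := s2Coords_mem_Icc hU hS hN hp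
  rw [Set.mem_Icc, Pi.le_def, Pi.le_def] at hm
  have hUlo : ((eU.encl.fst : ℚ) : ℝ) ≤ p .UOverT := by simpa [s2Lo, s2Coords] using hm.1 0
  have hUhi : p .UOverT ≤ ((eU.encl.snd : ℚ) : ℝ) := by simpa [s2Hi, s2Coords] using hm.2 0
  have hNlo : ((eN.encl.fst : ℚ) : ℝ) ≤ p .filling := by simpa [s2Lo, s2Coords] using hm.1 2
  have hNhi : p .filling ≤ ((eN.encl.snd : ℚ) : ℝ) := by simpa [s2Hi, s2Coords] using hm.2 2
  have hU0' : (0 : ℝ) ≤ ((eU.encl.fst : ℚ) : ℝ) := by exact_mod_cast hU0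
  have hN1' : (1 : ℝ) ≤ ((eN.encl.fst : ℚ) : ℝ) := by exact_mod_cast hN1
  have h1 : ((eU.encl.fst : ℚ) : ℝ) * (((eN.encl.fst : ℚ) : ℝ) - 1) ≤ p .UOverT * (p .filling - 1) :=
    mul_le_mul hUlo (by linarith) (by linarith) (hU0'.trans hUlo)
  have h2 : p .UOverT * (p .filling - 1) ≤ ((eU.encl.snd : ℚ) : ℝ) * (((eN.encl.snd : ℚ) : ℝ) - 1) :=
    mul_le_mul hUhi (by linarith) (by linarith) ((hU0'.trans hUlo).trans hUhi)
  exact ⟨by linarith [hw.1], by linarith [hw.2]⟩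

end Summit.Ventures.CertifiedManyBodySolver.Downfold

end
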